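import Mathlib.Analysis.Normed.Affine.AddTorsorBases
import Literature.Analysis.Convexity.ComplexTransport
import Literature.Analysis.Convexity.PLMap
import HarnessLib

/-!
# Triangulations of a simplex are pure

Let `P` be a finite geometric simplicial complex all of whose simplices lie in the closed simplex
of an affinely independent configuration `s` with `d + 1` points, and which covers that closed
simplex.  Then `P` is *pure of dimension `d`*: every simplex of `P` is a face of a simplex of
`P` with `d + 1` vertices (`exists_subset_card_eq_of_triangulation`).  The closed simplex of `s`
is in general not full-dimensional in the ambient space, so we first map it by an affine map
`β` which is injective on the affine span of `s` onto a full-dimensional simplex of `ℝᵈ`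
(`exists_affineMap_injOn_affineSpan`), transport `P` along `β`
(`Literature.Analysis.Convexity.exists_simplicialComplex_image`) and apply the purity theorem
`exists_subset_card_eq_finrank_add_one` there.  Used for the lattice refinements of the
coordinate complexes in the triangulation programme (each refined top simplex is again covered
by top simplices).  No named facts are introduced. [folklore]
-/

open Set Function

noncomputable section

namespace Literature.Analysis.Convexity

section Subcomplex

variable {E : Type*} [AddCommGroup E] [Module ℝ E]

/-- **Subcomplexes.** A family of faces of `K` closed under passing to nonempty subsets is the
set of faces of a simplicial complex. [folklore] -/
def subcomplexOf (K : Geometry.SimplicialComplex ℝ E) (F : Set (Finset E)) (hF : F ⊆ K.faces)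
    (hdown : ∀ s ∈ F, ∀ t ⊆ s, t.Nonempty → t ∈ F) : Geometry.SimplicialComplex ℝ E where
  faces := F
  indep hs := K.indep (hF hs)
  isRelLowerSet_faces := fun s hs =>
    ⟨K.nonempty_of_mem_faces (hF hs), fun t hts htn => hdown s hs t hts htn⟩
  inter_subset_convexHull hs ht := K.inter_subset_convexHull (hF hs) (hF ht)

/-- The faces of `subcomplexOf`. [folklore] -/
theorem subcomplexOf_faces (K : Geometry.SimplicialComplex ℝ E) (F : Set (Finset E))
    (hF : F ⊆ K.faces) (hdown : ∀ s ∈ F, ∀ t ⊆ s, t.Nonempty → t ∈ F) :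
    (subcomplexOf K F hF hdown).faces = F := rfl

end Subcomplex

section Injective

variable {W : Type*} [NormedAddCommGroup W] [NormedSpace ℝ W]
  {V : Type*} [NormedAddCommGroup V] [NormedSpace ℝ V]

/-- A point of the affine span of a finite set is an affine combination of its points.
(Local copy of the lemma of `StandardExtension`.) [folklore] -/
private theorem exists_weights_of_mem_affineSpan' {t : Finset W} {x : W}
    (hx : x ∈ affineSpan ℝ (t : Set W)) :
    ∃ w : W → ℝ, ∑ y ∈ t, w y = 1 ∧ ∑ y ∈ t, w y • y = x := by
  classical
  have hx' : x ∈ affineSpan ℝ (Set.range ((↑) : t → W)) := by rwa [Subtype.range_coe]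
  obtain ⟨w, hw1, hwx⟩ := eq_affineCombination_of_mem_affineSpan_of_fintype hx'
  rw [Finset.affineCombination_eq_linear_combination _ _ _ hw1] at hwx
  set w' : W → ℝ := fun y => if h : y ∈ t then w ⟨y, h⟩ else 0 with hw'
  have hww : ∀ i : t, w' i = w i := fun i => by simp only [hw', dif_pos i.2]
  refine ⟨w', ?_, ?_⟩
  · rw [← Finset.sum_coe_sort]; simp_rw [hww]; exact hw1
  · rw [← Finset.sum_coe_sort]; simp_rw [hww]; exact hwx.symm

/-- **Affine maps injective on an affine span.** If the images `β v`, `v ∈ t`, form an affinely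
independent family, then `β` is injective on the affine span of `t`. [folklore] -/
theorem injOn_affineSpan_of_affineIndependent {t : Finset W} (β : W →ᵃ[ℝ] V)
    (h : AffineIndependent ℝ (fun v : t => β v)) : InjOn β (affineSpan ℝ (t : Set W)) := by
  classical
  intro x hx y hy hxy
  obtain ⟨wx, hwx1, rfl⟩ := exists_weights_of_mem_affineSpan' hx
  obtain ⟨wy, hwy1, rfl⟩ := exists_weights_of_mem_affineSpan' hy
  rw [affineMap_apply_sum_smul (g := β) (fun v _ => rfl) hwx1,
    affineMap_apply_sum_smul (g := β) (fun v _ => rfl) hwy1] at hxy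
  have hdiff : ∑ v ∈ t, (wx v - wy v) • β v = 0 := by
    simp only [sub_smul, Finset.sum_sub_distrib, hxy, sub_self]
  have hsum : ∑ v ∈ t, (wx v - wy v) = 0 := by
    rw [Finset.sum_sub_distrib, hwx1, hwy1, sub_self]
  -- transfer to the subtype family and use affine independence
  have hsum' : ∑ i : t, (wx i - wy i) = 0 := by rw [Finset.sum_coe_sort t (fun v => wx v - wy v)]; exact hsum
  have hdiff' : ∑ i : t, (wx i - wy i) • β i = 0 := by
    rw [Finset.sum_coe_sort t (fun v => (wx v - wy v) • β v)]; exact hdiff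
  have hzero := h.eq_zero_of_sum_eq_zero hsum' hdiff'
  refine Finset.sum_congr rfl fun v hv => ?_
  have := hzero ⟨v, hv⟩ (Finset.mem_univ _)
  rw [sub_eq_zero] at this
  rw [this]

end Injective

section Pure

variable {W : Type*} [NormedAddCommGroup W] [NormedSpace ℝ W] [FiniteDimensional ℝ W]

/-- **A simplex can be mapped affinely and injectively onto a full-dimensional simplex.** For an
affinely independent `s` with `d + 1` points there is an affine map `β : W → ℝᵈ`, injective on
the affine span of `s`, mapping `s` onto an affinely independent configuration affinely spanning
`ℝᵈ`. [folklore] -/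
theorem exists_affineMap_injOn_affineSpan {s : Finset W} (hs : AffineIndependent ℝ ((↑) : s → W))
    {d : ℕ} (hcard : s.card = d + 1) :
    ∃ β : W →ᵃ[ℝ] (Fin d → ℝ), InjOn β (affineSpan ℝ (s : Set W)) ∧
      affineSpan ℝ (β '' (s : Set W)) = ⊤ := by
  classical
  have hc : Fintype.card ↥s = Module.finrank ℝ (Fin d → ℝ) + 1 := by
    rw [Fintype.card_coe, hcard, Module.finrank_fin_fun]
  obtain ⟨b⟩ := AffineBasis.exists_affineBasis_of_finiteDimensional (ι := ↥s) (k := ℝ)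
    (P := Fin d → ℝ) hc
  set g : W → (Fin d → ℝ) := fun v => if h : v ∈ s then b ⟨v, h⟩ else 0 with hg
  set β : W →ᵃ[ℝ] (Fin d → ℝ) := interp s hs g with hβ
  have hβv : ∀ v : ↥s, β v = b v := fun v => by
    rw [hβ, interp_apply_of_mem hs g v.2]
    simp only [hg, dif_pos v.2]
  have hfam : (fun v : ↥s => β v) = b := funext hβv
  refine ⟨β, injOn_affineSpan_of_affineIndependent β (hfam ▸ b.ind), ?_⟩
  have himg : β '' (s : Set W) = Set.range b := by
    ext y
    constructor
    · rintro ⟨v, hv, rfl⟩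
      exact ⟨⟨v, hv⟩, (hβv ⟨v, hv⟩).symm⟩
    · rintro ⟨v, rfl⟩
      exact ⟨v, v.2, hβv v⟩
  rw [himg]
  exact b.tot

/-- **Triangulations of a simplex are pure.** Let `P` be a finite complex whose simplices lie
in the closed simplex of the affinely independent configuration `s` (`#s = d + 1`) and which
covers it. Then every simplex of `P` is a face of a simplex of `P` with `d + 1` vertices.
[folklore] -/
theorem exists_subset_card_eq_of_triangulation [DecidableEq W] (P : Geometry.SimplicialComplex ℝ W)
    (hfin : P.faces.Finite) {s : Finset W} (hs : AffineIndependent ℝ ((↑) : s → W)) {d : ℕ}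
    (hcard : s.card = d + 1)
    (hsub : ∀ t ∈ P.faces, convexHull ℝ (t : Set W) ⊆ convexHull ℝ (s : Set W))
    (hcov : convexHull ℝ (s : Set W) ⊆ P.space) {t : Finset W} (ht : t ∈ P.faces) :
    ∃ t' ∈ P.faces, t ⊆ t' ∧ t'.card = d + 1 := by
  classical
  obtain ⟨β, hβinj, hβtop⟩ := exists_affineMap_injOn_affineSpan hs hcard
  -- `β` is injective on `P.space ⊆ convexHull s ⊆ affineSpan s`
  have hPs : P.space ⊆ affineSpan ℝ (s : Set W) := fun x hx => by
    obtain ⟨r, hr, hxr⟩ := Geometry.SimplicialComplex.mem_space_iff.1 hx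
    exact convexHull_subset_affineSpan _ (hsub r hr hxr)
  have hinj : InjOn β P.space := hβinj.mono hPs
  obtain ⟨P', hP'faces, hP'hull⟩ := exists_simplicialComplex_image P β
    (fun r _ => ⟨β, fun _ _ => rfl⟩) hinj
  -- the image complex is finite and covers the full-dimensional simplex `β '' conv s`
  have hP'fin : P'.faces.Finite := by
    have : P'.faces = (fun r => r.image β) '' P.faces := by
      ext r; rw [hP'faces]; simp [eq_comm]
    rw [this]; exact hfin.image _
  have hspace : P'.space = convexHull ℝ (β '' (s : Set W)) := by
    refine Subset.antisymm ?_ ?_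
    · intro y hy
      obtain ⟨_, hr', hyr⟩ := Geometry.SimplicialComplex.mem_space_iff.1 hy
      obtain ⟨r, hr, rfl⟩ := (hP'faces _).1 hr'
      rw [hP'hull r hr] at hyr
      obtain ⟨x, hx, rfl⟩ := hyr
      rw [← AffineMap.image_convexHull]
      exact ⟨x, hsub r hr hx, rfl⟩
    · rw [← AffineMap.image_convexHull]
      rintro _ ⟨x, hx, rfl⟩
      obtain ⟨r, hr, hxr⟩ := Geometry.SimplicialComplex.mem_space_iff.1 (hcov hx)
      refine Geometry.SimplicialComplex.mem_space_iff.2 ⟨r.image β, (hP'faces _).2 ⟨r, hr, rfl⟩, ?_⟩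
      rw [hP'hull r hr]
      exact ⟨x, hxr, rfl⟩
  have hint : (interior P'.space).Nonempty := by
    rw [hspace, interior_convexHull_nonempty_iff_affineSpan_eq_top]
    exact hβtop
  have hcl : P'.space ⊆ closure (interior P'.space) := by
    have hconv : Convex ℝ P'.space := by rw [hspace]; exact convex_convexHull ℝ _
    rw [hconv.closure_interior_eq_closure_of_nonempty_interior hint]
    exact subset_closure
  -- purity of the image complex
  have ht' : t.image β ∈ P'.faces := (hP'faces _).2 ⟨t, ht, rfl⟩
  obtain ⟨u', hu', htu', hcard'⟩ := exists_subset_card_eq_finrank_add_one hP'fin ht'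
    ((Geometry.SimplicialComplex.convexHull_subset_space ht').trans hcl)
  obtain ⟨u, hu, rfl⟩ := (hP'faces _).1 hu'
  rw [Module.finrank_fin_fun] at hcard'
  -- pull back: `t ⊆ u` and `#u = d + 1`
  have hinj_tu : InjOn β (↑(t ∪ u) : Set W) := hinj.mono (by
    rw [Finset.coe_union]
    exact Set.union_subset (P.subset_space ht) (P.subset_space hu))
  refine ⟨u, hu, fun v hv => ?_, ?_⟩
  · obtain ⟨v', hv', hvv'⟩ := Finset.mem_image.1 (htu' (Finset.mem_image_of_mem β hv))
    have := hinj_tu (by simp [hv']) (by simp [hv]) hvv'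
    rwa [← this]
  · rw [← hcard', Finset.card_image_of_injOn (hinj.mono (P.subset_space hu))]

end Pure



end Literature.Analysis.Convexity
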